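import Summits.AtomisticToContinuum.HydrodynamicLimit.Theorems.JParityClosureParityBandClosureWindowCovarianceIsotropyI
import HarnessLib

/-!
# Window covariance isotropy (crux `JParityClosure.ParityBandClosure`, stmt-AtomisticToContinuum-17608, line
# `transfer-weighted-parity-chain`, stub `stub_windowCovarianceIsotropy`) — helper J: GOOD windows

WHAT.  `good_window`: along a hard-sphere trajectory, for one window `(t₀, x₀)` which is non-dilute (`ρ_w ≥ ρ_min`),
passes the finitely many Metropolis-odd / floor / balance tests of `ParityStability` within `η`, and has record mass,
record second moment and cubic moment within the budget `M`, the deviator of the window covariance is at most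
`18 ρ_w (ε + ε²)`: `ParityStability` (as the implication it provides) applied to `(ν_w, κ_w, c₀ = g₀σ³ρ_w²)` through
the dictionary of helpers B–C (`oddFunctional_eq`, `floorFunctional_eq`, `markFunctional_eq`) and the deviator algebra
of helper I.  Also: the window quadratic tail (`integral_norm_sq_wlaw_le`), the cubic moment of `ν_w`, the mass and
second moment of `κ_w` in record form, and the cut-off cap `g(σ³ρ)ρ ≤ (η₀/σ³) g(σ³ρ)`.

REFERENCES.  The line's card (lead NOTES); C. Cercignani, R. Illner, M. Pulvirenti (1994) §3.  No named fact.
-/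

noncomputable section

namespace Summit.AtomisticToContinuum.HydrodynamicLimit.Theorems.ParityBandClosureWindowCovariance

open scoped BigOperators Topology Classical MeasureTheory ENNReal InnerProductSpace
open Filter Set MeasureTheory Function Topology
open Literature.MathematicalPhysics.KineticTheory
open Literature.Analysis.FluidPDE
open Summit.AtomisticToContinuum.HydrodynamicLimit.Theorems.LocalSecondLawNegative (cone cone_nonneg cone_le
  continuous_cone integral_cone_le)
open Summit.AtomisticToContinuum.HydrodynamicLimit.Theorems.ChaosClosesEulerStressIsotropy (sqTail sqTail_nonneg
  measurable_sqTail norm_sq_le_add_sqTail)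

variable {N : ℕ}

/-! ## §1 Small facts -/

/-- The cut-off caps the density it weighs: `g(σ³ρ) ρ ≤ (η₀/σ³) g(σ³ρ)` for `ρ ≥ 0` when `g ≥ 0` vanishes on
`[η₀, ∞)`. [folklore] -/
theorem cutoff_mul_le {g : ℝ → ℝ} {η₀ σ : ℝ} (hσ : 0 < σ) (hg0 : ∀ b, η₀ ≤ b → g b = 0) (hgnn : ∀ b, 0 ≤ g b)
    {ρ : ℝ} (_hρ : 0 ≤ ρ) : g (σ ^ 3 * ρ) * ρ ≤ η₀ / σ ^ 3 * g (σ ^ 3 * ρ) := by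
  by_cases h : η₀ ≤ σ ^ 3 * ρ
  · rw [hg0 _ h]; simp
  · rw [not_le] at h
    have hρ' : ρ ≤ η₀ / σ ^ 3 := by
      rw [le_div_iff₀ (by positivity)]; linarith [mul_comm ρ (σ ^ 3)]
    calc g (σ ^ 3 * ρ) * ρ ≤ g (σ ^ 3 * ρ) * (η₀ / σ ^ 3) := mul_le_mul_of_nonneg_left hρ' (hgnn _)
      _ = _ := by ring

section Window

variable {ε r τ t₀ : ℝ} {x₀ : T3} {γ : ℝ → Config (N + 1) (Fin 3) T3}

/-- The window quadratic tail above speed `V`, as a law-type functional. [folklore] -/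
theorem integral_norm_sq_wlaw_le (hγ : IsHardSphereTrajectory (Torus.geometry (Fin 3)) ε (N + 1) γ) (hr : 0 < r)
    (V : ℝ) :
    ∫ v, ‖v‖ ^ 2 ∂(wlaw r τ t₀ x₀ γ) ≤ V ^ 2 * rhoW r τ γ t₀ x₀ +
      ∫ s in Set.Icc (0 : ℝ) τ, btent r (s - t₀) * ∫ q, cone r q.1 x₀ * sqTail V q.2 ∂(empiricalMeasure (γ s)) := by
  haveI := isFiniteMeasure_wlaw (N := N) (τ := τ) (t₀ := t₀) (x₀ := x₀) (γ := γ) hr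
  set R := Real.sqrt (2 * configEnergy (γ 0)) with hRdef
  have hR : ∀ s k, ‖(γ s k).2‖ ≤ R := norm_vel_le_sqrt_of_isHardSphereTrajectory hγ
  have hR0 : 0 ≤ R := Real.sqrt_nonneg _
  have hγm := hγ.measurable_torus
  have hsq : ∀ v : V3, ‖v‖ ≤ R → |sqTail V v| ≤ R ^ 2 := fun v hv => by
    rw [abs_of_nonneg (sqTail_nonneg _ _)]
    unfold sqTail
    by_cases h : v ∈ {v : V3 | V < ‖v‖}
    · rw [Set.indicator_of_mem h]; exact pow_le_pow_left₀ (norm_nonneg _) hv 2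
    · rw [Set.indicator_of_notMem h]; positivity
  have hi1 : Integrable (fun v : V3 => ‖v‖ ^ 2) (wlaw r τ t₀ x₀ γ) :=
    integrable_wlaw hr hγm hR (measurable_norm.pow_const 2) fun v hv => by
      rw [abs_of_nonneg (by positivity)]; exact pow_le_pow_left₀ (norm_nonneg _) hv 2
  have hi2 : Integrable (sqTail V) (wlaw r τ t₀ x₀ γ) := integrable_wlaw hr hγm hR (measurable_sqTail V) hsq
  have hT : ∫ v, sqTail V v ∂(wlaw r τ t₀ x₀ γ) =
      ∫ s in Set.Icc (0 : ℝ) τ, btent r (s - t₀) * ∫ q, cone r q.1 x₀ * sqTail V q.2 ∂(empiricalMeasure (γ s)) :=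
    integral_wlaw hr hγm (measurable_sqTail V) fun s k => hsq _ (hR s k)
  calc ∫ v, ‖v‖ ^ 2 ∂(wlaw r τ t₀ x₀ γ) ≤ ∫ v, (V ^ 2 + sqTail V v) ∂(wlaw r τ t₀ x₀ γ) :=
        integral_mono hi1 ((integrable_const _).add hi2) fun v => norm_sq_le_add_sqTail V v
    _ = _ := by
        rw [integral_add (integrable_const _) hi2, integral_const, smul_eq_mul, measureReal_def,
          ← rhoW_eq_mass hr hγm, hT, mul_comm]

/-- The cubic moment of the normalised window law is the cubic law-type functional over the window mass. [folklore] -/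
theorem integral_norm_cube_nlaw_eq (hγ : IsHardSphereTrajectory (Torus.geometry (Fin 3)) ε (N + 1) γ) (hr : 0 < r)
    (hρ0 : 0 < rhoW r τ γ t₀ x₀) :
    Integrable (fun v : V3 => ‖v‖ ^ 3) ((ENNReal.ofReal (rhoW r τ γ t₀ x₀))⁻¹ • wlaw r τ t₀ x₀ γ) ∧
    ∫ v, ‖v‖ ^ 3 ∂((ENNReal.ofReal (rhoW r τ γ t₀ x₀))⁻¹ • wlaw r τ t₀ x₀ γ) = (rhoW r τ γ t₀ x₀)⁻¹ *
      ∫ s in Set.Icc (0 : ℝ) τ, btent r (s - t₀) * ∫ q, cone r q.1 x₀ * ‖q.2‖ ^ 3 ∂(empiricalMeasure (γ s)) := by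
  set R := Real.sqrt (2 * configEnergy (γ 0)) with hRdef
  have hR : ∀ s k, ‖(γ s k).2‖ ≤ R := norm_vel_le_sqrt_of_isHardSphereTrajectory hγ
  have hγm := hγ.measurable_torus
  have hb : ∀ v : V3, ‖v‖ ≤ R → |‖v‖ ^ 3| ≤ R ^ 3 := fun v hv => by
    rw [abs_of_nonneg (by positivity)]; exact pow_le_pow_left₀ (norm_nonneg _) hv 3
  have hi : Integrable (fun v : V3 => ‖v‖ ^ 3) (wlaw r τ t₀ x₀ γ) :=
    integrable_wlaw hr hγm hR (measurable_norm.pow_const 3) hb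
  have hcne : (ENNReal.ofReal (rhoW r τ γ t₀ x₀))⁻¹ ≠ ∞ :=
    ENNReal.inv_ne_top.2 (by rwa [Ne, ENNReal.ofReal_eq_zero, not_le])
  refine ⟨hi.smul_measure hcne, ?_⟩
  rw [integral_nlaw hρ0.le, integral_wlaw hr hγm (measurable_norm.pow_const 3) fun s k => hb _ (hR s k)]

/-- The mass and the second moment of the window record in record form. [folklore] -/
theorem wrec_mass_mom₂_eq (hγ : IsHardSphereTrajectory (Torus.geometry (Fin 3)) ε (N + 1) γ) (hε : 0 ≤ ε) (hr : 0 < r) :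
    ((wrec ε r τ t₀ x₀ γ) Set.univ).toReal = ε / (N + 1 : ℝ) *
      collisionPairSum (Torus.geometry (Fin 3)) ε γ (Set.Icc 0 τ) (fun s i _ => btent r (s - t₀) * cone r (γ s i).1 x₀) ∧
    ∫ q, (‖q.1.1‖ ^ 2 + ‖q.1.2‖ ^ 2) ∂(wrec ε r τ t₀ x₀ γ) = ε / (N + 1 : ℝ) *
      collisionPairSum (Torus.geometry (Fin 3)) ε γ (Set.Icc 0 τ) (fun s i j => btent r (s - t₀) * cone r (γ s i).1 x₀ *
        (‖(pvW (γ s) i j).1‖ ^ 2 + ‖(pvW (γ s) i j).2‖ ^ 2)) := by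
  refine ⟨wrec_univ_toReal hε hr (finite_collisionTimes_Icc hγ τ), ?_⟩
  rw [integral_wrec hε hr (finite_collisionTimes_Icc hγ τ), smul_eq_mul]
  rfl

/-- **A good window**: non-dilute, all tests passed, moments within budget ⇒ the deviator is at most
`18 ρ_w (ε + ε²)` (`ParityStability` on `(ν_w, κ_w, g₀σ³ρ_w²)` through the dictionary). [folklore] -/
theorem good_window (hγ : IsHardSphereTrajectory (Torus.geometry (Fin 3)) ε (N + 1) γ) (hε : 0 < ε)
    (hr : 0 < r)
    -- the cut-off
    {g : ℝ → ℝ} {η₀ Gb σ : ℝ} (hσ : 0 < σ) (_hη₀ : 0 ≤ η₀) (_hg0 : ∀ b, η₀ ≤ b → g b = 0) (_hgnn : ∀ b, 0 ≤ g b)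
    (_hGb : ∀ b, 0 ≤ b → g b ≤ Gb)
    -- the data of `ParityStability` and the implication it provides
    {n : ℕ} {Ψs Ξs : Fin n → (V3 × V3) × Metric.sphere (0 : V3) 1 → ℝ} {cs : Fin n → V3 → ℝ} {ϑs : Fin n → ℝ}
    {ηP M cmin εP : ℝ} (_hηP : 0 < ηP) (hM : 0 < M) (hεP : 0 ≤ εP) (hϑ : ∀ j, 0 < ϑs j ∧ ϑs j < 1)
    (HPS : ∀ (ν : Measure V3) [IsProbabilityMeasure ν] (κ : Measure ((V3 × V3) × Metric.sphere (0 : V3) 1))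
        [IsFiniteMeasure κ] (c₀ : ℝ), cmin ≤ c₀ →
        Integrable (fun v : V3 => ‖v‖ ^ 3) ν → ∫ v, ‖v‖ ^ 3 ∂ν ≤ M →
        (κ Set.univ).toReal ≤ M →
        Integrable (fun q : (V3 × V3) × Metric.sphere (0 : V3) 1 => ‖q.1.1‖ ^ 2 + ‖q.1.2‖ ^ 2) κ →
        ∫ q, (‖q.1.1‖ ^ 2 + ‖q.1.2‖ ^ 2) ∂κ ≤ M →
        let h : ℝ → V3 → ℝ := fun ϑ v => ∫ v', localMaxwellian 1 (ϑ ^ 2) v v' ∂ν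
        let F : ℝ → (V3 × V3) × Metric.sphere (0 : V3) 1 → ℝ := fun ϑ q =>
          Real.log (h ϑ q.1.1) + Real.log (h ϑ q.1.2) -
            Real.log (h ϑ (collide q.2 q.1).1) - Real.log (h ϑ (collide q.2 q.1).2)
        (∀ j, |∫ q, Ψs j q * min 1 (Real.exp (-(F (ϑs j) q))) ∂κ| ≤ ηP) →
        (∀ j, c₀ * ∫ q, Ξs j q * hardSphereKernel (q.1.2, q.1.1) q.2 ∂((ν.prod ν).prod sphereMeasure) ≤
          (∫ q, Ξs j q ∂κ) + ηP) →
        (∀ j, |∫ q, (cs j (collide q.2 q.1).1 + cs j (collide q.2 q.1).2 - cs j q.1.1 - cs j q.1.2) ∂κ| ≤ ηP) →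
        ∃ θ : ℝ, 0 ≤ θ ∧ ∃ u : V3, (∀ j : Fin 3, |(∫ v, v j ∂ν) - u j| ≤ εP) ∧
          ∀ j k : Fin 3, |(∫ v, (v j - u j) * (v k - u k) ∂ν) - (if j = k then θ else 0)| ≤ εP)
    -- the extended tests
    (hΞc : ∀ j, Continuous (Ξs j)) (hΞb : ∀ j, ∃ C : ℝ, ∀ q, |Ξs j q| ≤ C)
    {Ψt Ξt : Fin n → V3 × V3 × V3 → ℝ}
    (hΨt : ∀ j (m v w : V3) (hm : ‖m‖ = 1), Ψt j (m, v, w) = Ψs j ((v, w), ⟨m, mem_sphere_zero_iff_norm.2 hm⟩))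
    (hΞtc : ∀ j, Continuous (Ξt j)) (hΞtb : ∀ j, ∃ C : ℝ, ∀ p, |Ξt j p| ≤ C)
    (hΞt : ∀ j (m v w : V3) (hm : ‖m‖ = 1), Ξt j (m, v, w) = Ξs j ((v, w), ⟨m, mem_sphere_zero_iff_norm.2 hm⟩))
    -- the floor constant and the thresholds
    {g₀ ρmin V : ℝ} (hg₀ : 0 < g₀) (hρmin : 0 < ρmin) (hcmin : cmin = g₀ * σ ^ 3 * ρmin ^ 2) (_hV : 1 ≤ V)
    -- the balance tests are passed
    (hbal : ∀ j, |∫ q, (cs j (collide q.2 q.1).1 + cs j (collide q.2 q.1).2 - cs j q.1.1 - cs j q.1.2)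
      ∂(wrec ε r τ t₀ x₀ γ)| ≤ ηP)
    -- the window is good
    (hb1 : ρmin ≤ rhoW r τ γ t₀ x₀) (hb2 : ∀ j, |KwO ε r τ (ϑs j) (Ψt j) γ t₀ x₀| ≤ ηP)
    (hb3 : ∀ j, max (g₀ * σ ^ 3 * BwW r τ (Ξt j) γ t₀ x₀ - KwR ε r τ (Ξt j) γ t₀ x₀) 0 ≤ ηP)
    (hb4 : ε / (N + 1 : ℝ) * collisionPairSum (Torus.geometry (Fin 3)) ε γ (Set.Icc 0 τ)
      (fun s i _ => btent r (s - t₀) * cone r (γ s i).1 x₀) ≤ M)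
    (hb5 : ε / (N + 1 : ℝ) * collisionPairSum (Torus.geometry (Fin 3)) ε γ (Set.Icc 0 τ)
      (fun s i j => btent r (s - t₀) * cone r (γ s i).1 x₀ * (‖(pvW (γ s) i j).1‖ ^ 2 + ‖(pvW (γ s) i j).2‖ ^ 2)) ≤ M)
    (hb6 : (∫ s in Set.Icc (0 : ℝ) τ, btent r (s - t₀) * ∫ q, cone r q.1 x₀ * ‖q.2‖ ^ 3 ∂(empiricalMeasure (γ s))) ≤
      M * ρmin) :
    devW r τ γ t₀ x₀ ≤ 18 * rhoW r τ γ t₀ x₀ * (εP + εP ^ 2) := by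
  have hγm := hγ.measurable_torus
  haveI := isFiniteMeasure_wlaw (N := N) (τ := τ) (t₀ := t₀) (x₀ := x₀) (γ := γ) hr
  obtain ⟨R, hRdef⟩ : ∃ R : ℝ, R = Real.sqrt (2 * configEnergy (γ 0)) := ⟨_, rfl⟩
  have hR : ∀ s k, ‖(γ s k).2‖ ≤ R := fun s k => by rw [hRdef]; exact norm_vel_le_sqrt_of_isHardSphereTrajectory hγ s k
  obtain ⟨ρ, hρdef⟩ : ∃ ρ : ℝ, ρ = rhoW r τ γ t₀ x₀ := ⟨_, rfl⟩
  have hρpos' : 0 < rhoW r τ γ t₀ x₀ := hρmin.trans_le hb1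
  have hρpos : 0 < ρ := by rw [hρdef]; exact hρpos'
  have hρ0 : 0 ≤ ρ := hρpos.le
  rw [← hρdef] at hb1
  haveI hprob : IsProbabilityMeasure ((ENNReal.ofReal (rhoW r τ γ t₀ x₀))⁻¹ • wlaw r τ t₀ x₀ γ) :=
    isProbabilityMeasure_nlaw (τ := τ) (t₀ := t₀) (x₀ := x₀) hr hγm rfl hρpos'
  -- moments
  obtain ⟨hint3, hcube⟩ := integral_norm_cube_nlaw_eq (τ := τ) (t₀ := t₀) (x₀ := x₀) hγ hr hρpos'
  have hM1 : ∫ v, ‖v‖ ^ 3 ∂((ENNReal.ofReal (rhoW r τ γ t₀ x₀))⁻¹ • wlaw r τ t₀ x₀ γ) ≤ M := by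
    rw [hcube, ← hρdef]
    calc ρ⁻¹ * _ ≤ ρ⁻¹ * (M * ρmin) := mul_le_mul_of_nonneg_left hb6 (inv_nonneg.2 hρ0)
      _ ≤ ρ⁻¹ * (M * ρ) := mul_le_mul_of_nonneg_left (mul_le_mul_of_nonneg_left hb1 hM.le) (inv_nonneg.2 hρ0)
      _ = M := by field_simp
  obtain ⟨hmass, hmom2⟩ := wrec_mass_mom₂_eq (τ := τ) (t₀ := t₀) (x₀ := x₀) hγ hε.le hr
  have hM2 : ((wrec ε r τ t₀ x₀ γ) Set.univ).toReal ≤ M := by rw [hmass]; exact hb4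
  have hint2 : Integrable (fun q : (V3 × V3) × Metric.sphere (0 : V3) 1 => ‖q.1.1‖ ^ 2 + ‖q.1.2‖ ^ 2)
      (wrec ε r τ t₀ x₀ γ) := integrable_wrec _
  have hM3' : ∫ q, (‖q.1.1‖ ^ 2 + ‖q.1.2‖ ^ 2) ∂(wrec ε r τ t₀ x₀ γ) ≤ M := by rw [hmom2]; exact hb5
  have hc₀ : cmin ≤ g₀ * σ ^ 3 * ρ ^ 2 := by
    rw [hcmin]; exact mul_le_mul_of_nonneg_left (pow_le_pow_left₀ hρmin.le hb1 2) (by positivity)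
  -- the three test families (with `ν := ν_w`, `κ := κ_w` spelled out)
  obtain ⟨ν, hν⟩ : ∃ ν : Measure V3, ν = (ENNReal.ofReal (rhoW r τ γ t₀ x₀))⁻¹ • wlaw r τ t₀ x₀ γ := ⟨_, rfl⟩
  obtain ⟨κ, hκ⟩ : ∃ κ : Measure ((V3 × V3) × Metric.sphere (0 : V3) 1), κ = wrec ε r τ t₀ x₀ γ := ⟨_, rfl⟩
  haveI : IsProbabilityMeasure ν := by rw [hν]; exact hprob
  haveI : IsFiniteMeasure κ := by rw [hκ]; exact isFiniteMeasure_wrec ε r τ t₀ x₀ γ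
  rw [← hν] at hint3 hM1
  rw [← hκ] at hM2 hint2 hM3'
  have ho : ∀ j, |∫ q, Ψs j q * min 1 (Real.exp (-(Real.log (∫ v', localMaxwellian 1 (ϑs j ^ 2) q.1.1 v' ∂ν) +
      Real.log (∫ v', localMaxwellian 1 (ϑs j ^ 2) q.1.2 v' ∂ν) -
      Real.log (∫ v', localMaxwellian 1 (ϑs j ^ 2) (collide q.2 q.1).1 v' ∂ν) -
      Real.log (∫ v', localMaxwellian 1 (ϑs j ^ 2) (collide q.2 q.1).2 v' ∂ν)))) ∂κ| ≤ ηP := by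
    intro j
    have hid := oddFunctional_eq (τ := τ) (t₀ := t₀) (x₀ := x₀) hγ hε hr rfl hρpos' (hϑ j).1.ne' (hΨt j)
      (hwW r τ (ϑs j) γ t₀ x₀) (fun a => ∫ v', localMaxwellian 1 (ϑs j ^ 2) a v' ∂ν) (fun a => rfl)
      (fun a => by rw [hν]; rfl)
      (fun s i j => pvW (γ s) i j) (fun s i j => rfl)
      (fun s i j' => Real.log (hwW r τ (ϑs j) γ t₀ x₀ (pvW (γ s) i j').1) +
        Real.log (hwW r τ (ϑs j) γ t₀ x₀ (pvW (γ s) i j').2) -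
        Real.log (hwW r τ (ϑs j) γ t₀ x₀ (γ s i).2) - Real.log (hwW r τ (ϑs j) γ t₀ x₀ (γ s j').2)) (fun s i j' => rfl)
      (fun q => Real.log (∫ v', localMaxwellian 1 (ϑs j ^ 2) q.1.1 v' ∂ν) +
        Real.log (∫ v', localMaxwellian 1 (ϑs j ^ 2) q.1.2 v' ∂ν) -
        Real.log (∫ v', localMaxwellian 1 (ϑs j ^ 2) (collide q.2 q.1).1 v' ∂ν) -
        Real.log (∫ v', localMaxwellian 1 (ϑs j ^ 2) (collide q.2 q.1).2 v' ∂ν)) (fun q => rfl)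
    have h2 : KwO ε r τ (ϑs j) (Ψt j) γ t₀ x₀ = _ := (KwO_eq (r := r) (τ := τ) (t₀ := t₀) (x₀ := x₀) hγ (ϑs j) (Ψt j)).trans hid
    have h3 := hb2 j
    rw [h2] at h3
    rw [hκ]
    exact h3
  have hf : ∀ j, g₀ * σ ^ 3 * ρ ^ 2 * ∫ q, Ξs j q * hardSphereKernel (q.1.2, q.1.1) q.2 ∂((ν.prod ν).prod sphereMeasure) ≤
      (∫ q, Ξs j q ∂κ) + ηP := by
    intro j
    obtain ⟨C, hC⟩ := hΞb j
    obtain ⟨Ct, hCt⟩ := hΞtb j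
    have hfl := floorFunctional_eq (τ := τ) (t₀ := t₀) (x₀ := x₀) hγ hr rfl hρpos' (hΞc j) hC (hΞtc j) hCt (hΞt j)
    have hmk0 := markFunctional_eq (τ := τ) (t₀ := t₀) (x₀ := x₀) hγ hε hr (hΞt j) (fun s i j => pvW (γ s) i j)
      (fun s i j => rfl)
    have hmk : KwR ε r τ (Ξt j) γ t₀ x₀ = _ := (KwR_eq (r := r) (τ := τ) (t₀ := t₀) (x₀ := x₀) hγ (Ξt j)).trans hmk0
    have hB : BwW r τ (Ξt j) γ t₀ x₀ = ρ ^ 2 * ∫ q, Ξs j q * hardSphereKernel (q.1.2, q.1.1) q.2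
        ∂((ν.prod ν).prod sphereMeasure) := by rw [hν, hρdef]; exact hfl
    have hgood := hb3 j
    rw [max_le_iff] at hgood
    have hmk' : ∫ q, Ξs j q ∂κ = KwR ε r τ (Ξt j) γ t₀ x₀ := by rw [hκ]; exact hmk.symm
    have e : g₀ * σ ^ 3 * ρ ^ 2 * ∫ q, Ξs j q * hardSphereKernel (q.1.2, q.1.1) q.2 ∂((ν.prod ν).prod sphereMeasure) =
        g₀ * σ ^ 3 * BwW r τ (Ξt j) γ t₀ x₀ := by rw [hB]; ring
    linarith [hgood.1, hmk'.le, hmk'.ge, e.le, e.ge]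
  obtain ⟨θ, -, u, hu1, hu2⟩ := HPS ν κ (g₀ * σ ^ 3 * ρ ^ 2) hc₀ hint3 hM1 hM2 hint2 hM3' ho hf
    (fun j => by rw [hκ]; exact hbal j)
  rw [hν] at hu1 hu2
  exact devW_le_of_isotropic (τ := τ) (t₀ := t₀) (x₀ := x₀) hr hγm hR hρpos' hεP u hu1 hu2

end Window

/-- **Registered sub-goal `stub_wciCutoffCap` (helper J of `stub_windowCovarianceIsotropy`): the density cut-off caps
the density it weighs** — `g(σ³ρ) ρ ≤ (η₀/σ³) g(σ³ρ)` for a nonnegative cut-off vanishing on `[η₀, ∞)`; this is why no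
density cap beyond the band is needed to price the bad windows. [folklore] -/
theorem stub_wciCutoffCap : ∀ {g : ℝ → ℝ} {η₀ σ : ℝ}, 0 < σ → (∀ b, η₀ ≤ b → g b = 0) → (∀ b, 0 ≤ g b) → ∀ {ρ : ℝ}, 0 ≤ ρ → g (σ ^ 3 * ρ) * ρ ≤ η₀ / σ ^ 3 * g (σ ^ 3 * ρ) :=
  fun hσ hg0 hgnn _ hρ => cutoff_mul_le hσ hg0 hgnn hρ

end Summit.AtomisticToContinuum.HydrodynamicLimit.Theorems.ParityBandClosureWindowCovariance

end
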